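import Summits.Schanuel.Schanuel.Theorems.ZilberEacPlaneCurveRows
import Summits.Schanuel.Schanuel.Theorems.ZilberEacWeightedPlaces
import HarnessLib

/-!
# Arbitrary base branches, LXIV: polynomial fibres over an ARBITRARY irreducible plane curve
# (monic or not) along a place at infinity with a good direction — case ∧ dense

HONEST FRAMING.  Cell `pub-schanuel` (Zilber's Exponential-Algebraic Closedness, case ladder;
host summit Schanuel), seat 2, gen 31.  File LIV with monicity removed (file LXIII supplies the
algebra): `F ∈ ℂ[x₀][x₁]` IRREDUCIBLE of `x₁`-degree `n ≥ 2` with leading row `a(x₀)`;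
* **`planeCurve_exists_root`** (a point over every `x₀` with `a(x₀) ≠ 0`),
  **`planeCurve_exists_offLine`** (the curve lies on no line: Bézout against the line's rows, or two
  fibres), **`mmCase_planeCurve_polyFibre`** (`{F = 0, y₀ = R}` is in Mantova–Masser's case for
  every `R` nonzero somewhere on the curve);
* **`unprojectedDense_planeCurve_polyFibre`** — along a place `x₀ = s^{-k}`, `x₁ = Φ(s)s^{-M}`
  (`k, M ≥ 1`) with a good direction `Re(Φ(0)z^M) ≠ 0`, `z^k = 2πi`: Zariski-dense exponential
  points, for every `R` nonzero somewhere on the curve;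
* **`unprojectedDensityQuestion_planeCurve_polyFibre_of_weightedTopRow`** — the place constructed
  from a root of a weighted top row (file LX (a)): weights `(k, M)`, any `Q(s, t) = F(s^k, s^M t)`,
  a top-row root `θ` with a good direction ⟹ case ∧ dense.  For a non-monic curve the Newton
  polygon at infinity may have NO edge with both exponents positive (`x₀x₁² = 1`: along every
  branch one coordinate stays bounded) — such curves are outside the growth method.
Decided instances of an OPEN question (Mantova–Masser, PLMS 2024 §1 p. 5); EC(3,2) OPEN; NOT
Schanuel's conjecture (neither used nor implied); EAC ⇏ SC.
-/

noncomputable section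

open Filter Topology Set Complex Polynomial
open Literature.NumberTheory.Transcendental Literature.ModelTheory.Zilber
open Literature.ModelTheory.ExponentialFields

set_option linter.dupNamespace false

namespace Summit.Schanuel.Schanuel.Theorems

section PlaneCurve

variable (F : ℂ[X][X])

/-! ## Part A. Points of the curve and the case certificate -/

/-- Over every `x₀` with `a(x₀) ≠ 0` (`a` the leading row, `deg_{x₁} F ≥ 1`) the curve `F = 0` has
a point. [folklore] -/
theorem planeCurve_exists_root (hn : 1 ≤ F.natDegree) {x : ℂ} (hx : F.leadingCoeff.eval x ≠ 0) :
    ∃ y : ℂ, (F.map (Polynomial.evalRingHom x)).eval y = 0 := by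
  have hnd : (F.map (Polynomial.evalRingHom x)).natDegree = F.natDegree :=
    Polynomial.natDegree_map_of_leadingCoeff_ne_zero _ (by rwa [Polynomial.coe_evalRingHom])
  have hne : F.map (Polynomial.evalRingHom x) ≠ 0 := by
    intro h
    rw [h, Polynomial.natDegree_zero] at hnd
    omega
  have hdeg : (F.map (Polynomial.evalRingHom x)).degree ≠ 0 := by
    rw [Polynomial.degree_eq_natDegree hne, hnd]
    exact_mod_cast (by omega : F.natDegree ≠ 0)
  obtain ⟨y, hy⟩ := IsAlgClosed.exists_root _ hdeg
  exact ⟨y, hy⟩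

/-- **An irreducible plane curve of `x₁`-degree `≥ 2` lies on no line.** [folklore] -/
theorem planeCurve_exists_offLine (hFirr : Irreducible F) (hn : 2 ≤ F.natDegree)
    (m : Fin 2 → ℤ) (hm : m ≠ 0) (c₀ : ℂ) :
    ∃ x y : ℂ, (F.map (Polynomial.evalRingHom x)).eval y = 0 ∧
      (m 0 : ℂ) * x + (m 1 : ℂ) * y ≠ c₀ := by
  classical
  set a : ℂ[X] := F.leadingCoeff with ha
  have ha0 : a ≠ 0 := by
    rw [ha, Ne, Polynomial.leadingCoeff_eq_zero]
    rintro rfl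
    rw [Polynomial.natDegree_zero] at hn
    omega
  by_contra hall
  push Not at hall
  by_cases hm1 : (m 1 : ℂ) = 0
  · have hm0 : (m 0 : ℂ) ≠ 0 := by
      intro h0
      apply hm
      funext i
      fin_cases i
      · exact_mod_cast h0
      · exact_mod_cast hm1
    -- the polynomial `a · (m₀ X − c₀)` would vanish identically
    have hzero : a * (C (m 0 : ℂ) * X - C c₀) = 0 := by
      refine Polynomial.funext fun x => ?_
      rw [Polynomial.eval_zero, Polynomial.eval_mul]
      by_cases hx : a.eval x = 0
      · rw [hx, zero_mul]
      · obtain ⟨y, hy⟩ := planeCurve_exists_root F (by omega) hx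
        have h := hall x y hy
        rw [hm1, zero_mul, add_zero] at h
        simp only [Polynomial.eval_sub, Polynomial.eval_mul, Polynomial.eval_C, Polynomial.eval_X, h,
          sub_self, mul_zero]
    rcases mul_eq_zero.1 hzero with h | h
    · exact ha0 h
    · have := congrArg (fun p : ℂ[X] => p.coeff 1) h
      simp only [Polynomial.coeff_sub, Polynomial.coeff_C_mul, Polynomial.coeff_X_one, mul_one,
        Polynomial.coeff_C_succ, sub_zero, Polynomial.coeff_zero] at this
      exact hm0 this
  · set Rl : ℂ[X][X] := C (C (m 1 : ℂ)) * X + C (C (m 0 : ℂ) * X - C c₀) with hRl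
    have hRl1 : Rl.natDegree ≤ 1 := Polynomial.natDegree_linear_le
    have hRl0 : Rl ≠ 0 := by
      intro h
      have h1 := congrArg (fun p : ℂ[X][X] => (p.coeff 1).coeff 0) h
      simp only [hRl, Polynomial.coeff_add, Polynomial.coeff_C_mul, Polynomial.coeff_X_one, mul_one,
        Polynomial.coeff_C_succ, add_zero, Polynomial.coeff_C_zero, Polynomial.coeff_zero] at h1
      exact hm1 h1
    obtain ⟨U, V, D, hD, hUV⟩ := exists_bezout_of_irreducible' F Rl hFirr (by omega) hRl0 (by omega)
    -- `D · a` vanishes identically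
    have hzero : D * a = 0 := by
      refine Polynomial.funext fun x => ?_
      rw [Polynomial.eval_zero, Polynomial.eval_mul]
      by_cases hx : a.eval x = 0
      · rw [hx, mul_zero]
      · obtain ⟨y, hy⟩ := planeCurve_exists_root F (by omega) hx
        have hline := hall x y hy
        have hRl_eval : (Rl.map (Polynomial.evalRingHom x)).eval y = 0 := by
          simp only [hRl, Polynomial.map_add, Polynomial.map_mul, Polynomial.map_C,
            Polynomial.map_X, Polynomial.eval_add, Polynomial.eval_mul, Polynomial.eval_sub,
            Polynomial.eval_C, Polynomial.eval_X, Polynomial.coe_evalRingHom]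
          linear_combination hline
        have h := congrArg (fun G : ℂ[X][X] => (G.map (Polynomial.evalRingHom x)).eval y) hUV
        simp only [Polynomial.map_add, Polynomial.map_mul, Polynomial.eval_add, Polynomial.eval_mul, hy,
          hRl_eval, mul_zero, add_zero, Polynomial.map_C, Polynomial.eval_C,
          Polynomial.coe_evalRingHom] at h
        rw [← h, zero_mul]
    rcases mul_eq_zero.1 hzero with h | h
    · exact hD h
    · exact ha0 h

/-- **The cylinder `{F(x₀, x₁) = 0, y₀ = R(x₀, x₁)}` over an irreducible plane curve of
`x₁`-degree `≥ 2` is in Mantova–Masser's case** (`R` nonzero somewhere on the curve). (new) -/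
theorem mmCase_planeCurve_polyFibre (hFirr : Irreducible F) (hn : 2 ≤ F.natDegree)
    (R : MvPolynomial (Fin 2) ℂ)
    (hR : ∃ x y : ℂ, (F.map (Polynomial.evalRingHom x)).eval y = 0 ∧ MvPolynomial.eval ![x, y] R ≠ 0) :
    MMCaseDimPiOneFree {w : Fin 2 ⊕ Fin 2 → ℂ |
      (F.map (Polynomial.evalRingHom (w (Sum.inl 0)))).eval (w (Sum.inl 1)) = 0 ∧
      w (Sum.inr 0) = MvPolynomial.eval ![w (Sum.inl 0), w (Sum.inl 1)] R} := by
  classical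
  obtain ⟨Φr, hΦr⟩ := exists_rowsEquiv
  set A : MvPolynomial (Fin 2) ℂ := Φr.symm F with hA
  have hPQ : ∀ x y : ℂ, MvPolynomial.eval ![x, y] A = (F.map (Polynomial.evalRingHom x)).eval y := by
    intro x y
    rw [hΦr, hA, RingEquiv.apply_symm_apply]
  have hirrA : Irreducible A := (irreducible_rows_iff hPQ).2 hFirr
  have hset : {w : Fin 2 ⊕ Fin 2 → ℂ |
      (F.map (Polynomial.evalRingHom (w (Sum.inl 0)))).eval (w (Sum.inl 1)) = 0 ∧
      w (Sum.inr 0) = MvPolynomial.eval ![w (Sum.inl 0), w (Sum.inl 1)] R} =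
      {w : Fin 2 ⊕ Fin 2 → ℂ | MvPolynomial.eval ![w (Sum.inl 0), w (Sum.inl 1)] A = 0 ∧
        w (Sum.inr 0) = MvPolynomial.eval ![w (Sum.inl 0), w (Sum.inl 1)] R} := by
    ext w
    simp only [Set.mem_setOf_eq, hPQ]
  rw [hset]
  refine mmCase_curveGraphFibre hirrA ?_ ?_
  · obtain ⟨x, y, hxy, hne⟩ := hR
    exact ⟨![x, y], by rw [hPQ]; exact hxy, hne⟩
  · intro m hm c₀
    obtain ⟨x, y, hxy, hne⟩ := planeCurve_exists_offLine F hFirr hn m hm c₀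
    exact ⟨![x, y], by rw [hPQ]; exact hxy, by simpa using hne⟩

/-! ## Part B. Density along a good place -/

/-- **Polynomial fibres over an irreducible plane curve along a good place: dense** (non-monic
version of file LIV).  `F` irreducible of positive `x₁`-degree; a place `x₀ = s^{-k}`,
`x₁ = Φ(s)s^{-M}` (`k, M ≥ 1`, `Φ` analytic) with `Re(Φ(0)z^M) ≠ 0` for some `z^k = 2πi`; `R`
nonzero somewhere on the curve. [cite: MantovaMasser2023, §1 Further remarks, p. 5 (the question,
open in general)] (new) -/
theorem unprojectedDense_planeCurve_polyFibre (hFirr : Irreducible F) (hn : 1 ≤ F.natDegree)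
    {k M : ℕ} (hk : 1 ≤ k) (hM : 1 ≤ M) {Φ : ℂ → ℂ} (hΦan : AnalyticAt ℂ Φ 0)
    (hplace : ∀ᶠ s in 𝓝[≠] (0 : ℂ),
      (F.map (Polynomial.evalRingHom (s ^ k)⁻¹)).eval (Φ s * (s ^ M)⁻¹) = 0)
    (hdir : ∃ z : ℂ, z ^ k = 2 * Real.pi * I ∧ (Φ 0 * z ^ M).re ≠ 0)
    (R : MvPolynomial (Fin 2) ℂ)
    (hR : ∃ x y : ℂ, (F.map (Polynomial.evalRingHom x)).eval y = 0 ∧ MvPolynomial.eval ![x, y] R ≠ 0) :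
    UnprojectedDense {w : Fin 2 ⊕ Fin 2 → ℂ |
      (F.map (Polynomial.evalRingHom (w (Sum.inl 0)))).eval (w (Sum.inl 1)) = 0 ∧
      w (Sum.inr 0) = MvPolynomial.eval ![w (Sum.inl 0), w (Sum.inl 1)] R} := by
  classical
  obtain ⟨Φr, hΦr⟩ := exists_rowsEquiv
  set A : MvPolynomial (Fin 2) ℂ := Φr.symm F with hA
  have hPQ : ∀ x y : ℂ, MvPolynomial.eval ![x, y] A = (F.map (Polynomial.evalRingHom x)).eval y := by
    intro x y
    rw [hΦr, hA, RingEquiv.apply_symm_apply]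
  have hirrA : Irreducible A := (irreducible_rows_iff hPQ).2 hFirr
  have hset : {w : Fin 2 ⊕ Fin 2 → ℂ |
      (F.map (Polynomial.evalRingHom (w (Sum.inl 0)))).eval (w (Sum.inl 1)) = 0 ∧
      w (Sum.inr 0) = MvPolynomial.eval ![w (Sum.inl 0), w (Sum.inl 1)] R} =
      {w : Fin 2 ⊕ Fin 2 → ℂ | MvPolynomial.eval ![w (Sum.inl 0), w (Sum.inl 1)] A = 0 ∧
        w (Sum.inr 0) = MvPolynomial.eval ![w (Sum.inl 0), w (Sum.inl 1)] R} := by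
    ext w
    simp only [Set.mem_setOf_eq, hPQ]
  rw [hset]
  have hS := isIrreducibleClosed_curveGraphFibre R hirrA
  have hdim := zariskiDim_curveGraphFibre R hirrA
  -- `F ∤ Φr R`
  have hndvd : ¬ F ∣ Φr R := by
    refine not_dvd_of_exists_eval_ne_zero F ?_
    obtain ⟨x, y, hxy, hne⟩ := hR
    exact ⟨x, y, hxy, by rw [← hΦr]; exact hne⟩
  obtain ⟨ψ, L, hψan, hψ0, hf⟩ :=
    exists_rows_place_normalForm F hFirr hn (Φr R) hndvd hk M hΦan hplace
  refine unprojectedDense_branch_poleFibre_of_exists_direction hS (le_of_eq hdim) hk hM L hψan hψ0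
    hΦan hdir ?_
  filter_upwards [hplace, hf] with s hs hfs
  refine ⟨?_, ?_⟩
  · simp only [Sum.elim_inl, Matrix.cons_val_zero, Matrix.cons_val_one]
    rw [hPQ]
    exact hs
  · simp only [Sum.elim_inr, Sum.elim_inl, Matrix.cons_val_zero, Matrix.cons_val_one]
    rw [hΦr, hfs]

/-- **Mantova–Masser's question over an arbitrary irreducible plane curve along a good place:
case ∧ dense** (`deg_{x₁} F ≥ 2`). [cite: MantovaMasser2023, §1 Further remarks, p. 5 (the
question, open in general)] (new) -/
theorem unprojectedDensityQuestion_planeCurve_polyFibre (hFirr : Irreducible F) (hn : 2 ≤ F.natDegree)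
    {k M : ℕ} (hk : 1 ≤ k) (hM : 1 ≤ M) {Φ : ℂ → ℂ} (hΦan : AnalyticAt ℂ Φ 0)
    (hplace : ∀ᶠ s in 𝓝[≠] (0 : ℂ),
      (F.map (Polynomial.evalRingHom (s ^ k)⁻¹)).eval (Φ s * (s ^ M)⁻¹) = 0)
    (hdir : ∃ z : ℂ, z ^ k = 2 * Real.pi * I ∧ (Φ 0 * z ^ M).re ≠ 0)
    (R : MvPolynomial (Fin 2) ℂ)
    (hR : ∃ x y : ℂ, (F.map (Polynomial.evalRingHom x)).eval y = 0 ∧ MvPolynomial.eval ![x, y] R ≠ 0) :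
    MMCaseDimPiOneFree {w : Fin 2 ⊕ Fin 2 → ℂ |
        (F.map (Polynomial.evalRingHom (w (Sum.inl 0)))).eval (w (Sum.inl 1)) = 0 ∧
        w (Sum.inr 0) = MvPolynomial.eval ![w (Sum.inl 0), w (Sum.inl 1)] R} ∧
      UnprojectedDense {w : Fin 2 ⊕ Fin 2 → ℂ |
        (F.map (Polynomial.evalRingHom (w (Sum.inl 0)))).eval (w (Sum.inl 1)) = 0 ∧
        w (Sum.inr 0) = MvPolynomial.eval ![w (Sum.inl 0), w (Sum.inl 1)] R} :=
  ⟨mmCase_planeCurve_polyFibre F hFirr hn R hR,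
    unprojectedDense_planeCurve_polyFibre F hFirr (by omega) hk hM hΦan hplace hdir R hR⟩

/-! ## Part C. The place from a weighted top row -/

/-- **Every weighted top-row root with a good direction decides the question, for an arbitrary
irreducible plane curve.**  `F` irreducible of `x₁`-degree `≥ 2`; weights `(k, M)`, `k, M ≥ 1`;
any `Q` with `Q(s, t) = F(s^k, s^M t)`, rows of degree `≤ N`, top row `T ≠ 0`, a root `θ` of `T`
with `Re(θ z^M) ≠ 0` for some `z^k = 2πi`; `R` nonzero somewhere on the curve: case ∧ dense.
[cite: MantovaMasser2023, §1 Further remarks, p. 5 (the question, open in general)] (new) -/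
theorem unprojectedDensityQuestion_planeCurve_polyFibre_of_weightedTopRow (hFirr : Irreducible F)
    (hn : 2 ≤ F.natDegree) {k M : ℕ} (hk : 1 ≤ k) (hM : 1 ≤ M) (Q : ℂ[X][X])
    (hQ : ∀ s t : ℂ, (Q.map (Polynomial.evalRingHom s)).eval t =
      (F.map (Polynomial.evalRingHom (s ^ k))).eval (s ^ M * t))
    (N : ℕ) (hN : ∀ j, (Q.coeff j).natDegree ≤ N) (T : ℂ[X]) (hT : ∀ j, T.coeff j = (Q.coeff j).coeff N)
    (hT0 : T ≠ 0) {θ : ℂ} (hTθ : T.IsRoot θ)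
    (hdir : ∃ z : ℂ, z ^ k = 2 * Real.pi * I ∧ (θ * z ^ M).re ≠ 0)
    (R : MvPolynomial (Fin 2) ℂ)
    (hR : ∃ x y : ℂ, (F.map (Polynomial.evalRingHom x)).eval y = 0 ∧ MvPolynomial.eval ![x, y] R ≠ 0) :
    MMCaseDimPiOneFree {w : Fin 2 ⊕ Fin 2 → ℂ |
        (F.map (Polynomial.evalRingHom (w (Sum.inl 0)))).eval (w (Sum.inl 1)) = 0 ∧
        w (Sum.inr 0) = MvPolynomial.eval ![w (Sum.inl 0), w (Sum.inl 1)] R} ∧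
      UnprojectedDense {w : Fin 2 ⊕ Fin 2 → ℂ |
        (F.map (Polynomial.evalRingHom (w (Sum.inl 0)))).eval (w (Sum.inl 1)) = 0 ∧
        w (Sum.inr 0) = MvPolynomial.eval ![w (Sum.inl 0), w (Sum.inl 1)] R} := by
  obtain ⟨e, Φ, he, hΦan, hΦ0, hplace⟩ := exists_place_of_weightedTopRow F
    (exists_bezout_derivative hFirr (by omega)) hk M Q hQ N hN T hT hT0 hTθ
  have hdir' := exists_direction_mul he hdir
  rw [← hΦ0] at hdir'
  exact unprojectedDensityQuestion_planeCurve_polyFibre F hFirr hn (Nat.mul_le_mul he hk)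
    (Nat.mul_le_mul he hM) hΦan hplace hdir' R hR

end PlaneCurve

end Summit.Schanuel.Schanuel.Theorems

end
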